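/-
Copyright (c) 2026 the pub-hodgecm-mathlib formalisation cell (harness21).  Prover seat hodgecm-mathlib-K2E4-p07 (g3), Track B «K2-LIT» ∕ h413
(stmt-HodgeConjecture-24833), socket #22S road, F-B (LIFT_v) — KIT for (L2) «orbital integrals see only the conjugation-average»: three frame-light lemmas on
the `H`-side stable orbital integral `Φ^st_H` of `H_v = U(Φ₂)(L⁺_v) × U(Φ₁)(L⁺_v)`.  2026-09-04.
-/
import Literature.NumberTheory.Rogawski1990.LocalTransferSplitPlaceClasses          -- ★ `stableOrbitalIntegralRel_isLocalStablyConjH_eq_of_split` (split: stable = ordinary)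
import Literature.NumberTheory.Rogawski1990.LocalTransferGlueCM                      -- ★ `localStableOrbitalIntegralH_add_of_isLocSmooth` (Φ^st_H additive on C_c^∞ at G-regular points)
import Literature.NumberTheory.Rogawski1990.LocalTransferCompactSideJunctionCM       -- ★ `isLocalGRegular_of_isLocalStablyConjH`
import Literature.NumberTheory.Automorphic.LocalEndoscopicOrbitClosed                -- ★ `localStableOrbitalIntegralH_smul_fun`
import Literature.NumberTheory.Automorphic.OrbitalIntegralSupportLocalisation         -- ★ `isLocSmooth_comp_conj`
import Literature.NumberTheory.Rogawski1990.SmoothTransferSplitPlaceHSide            -- ★ (L4) `orbitalIntegral_mul_of_forall_conj_eq`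
import Literature.NumberTheory.Automorphic.LocalOrbitalIntegral                      -- ★ `orbitalIntegral_conj_eq`, `classOrbitalIntegral_eq`
import HarnessLib

/-!
# K2_E4 road (h413 = stmt-HodgeConjecture-24833), socket #22S, letter (LIFT_v) — KIT (L2): class-function factors, conjugation and finite conjugation-averages under `Φ^st_H`

Cell `pub/hodgecm-mathlib` (D-0151), Track B «K2-LIT»; dealer K2E4-plan (g2) RE-DEAL 01:03:11Z: F-B (LIFT_v) `sig_K2E4SplitTransferGermLift` = (L1) «test-function lift»
(K2E4-p01 (g3)) + (L2) «orbital integrals see only the conjugation-average» + assembly (K2E4-p07 (g3), this seat).  THIS FILE is the frame-light kit of (L2) on the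
`H`-side carrier `H_v = U(Φ₂)(L⁺_v) × U(Φ₁)(L⁺_v)` (★ `UnitaryGroup.cmDatum … .Local v`), for the stable orbital integral
`Φ^st_H(γ, f) = stableOrbitalIntegralRel (IsLocalStablyConjH L v) mHv f γ` of ★ `IsLocalDeltaTransfer`:

* §1 **`stableOrbitalIntegralRel_mul_of_forall_conj_eq_of_split`** — at a SPLIT place, a conjugation-invariant factor comes out:
  `Φ^st_H(γ, g·ψ) = g(γ)·Φ^st_H(γ, ψ)` (stable = ordinary conjugacy at split `v`, ★ `stableOrbitalIntegralRel_isLocalStablyConjH_eq_of_split`; ★ (L4)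
  `orbitalIntegral_mul_of_forall_conj_eq`).  No measure hypothesis.  (The slot for the split transfer's weight `c(νG,νH)·μ_w(det (e₂ h.1))` of ★ `cmSplitTransfer_apply`.)
* §2 **`stableOrbitalIntegralRel_comp_conj`** — `Φ^st_H(γ, f ∘ Ad k) = Φ^st_H(γ, f)` at every `G`-regular `γ`, every finite `v`, for a family admissible on the
  `G`-regular classes (each member of the stable class is `G`-regular, ★ `isLocalGRegular_of_isLocalStablyConjH`; the admissible member is `H_v`-invariant, ★
  `orbitalIntegral_conj_eq`).
* §3 **`stableOrbitalIntegralRel_sum_conj`** — the finite conjugation sum: `Φ^st_H(γ, x ↦ Σ_i f(k_i x k_i⁻¹)) = n · Φ^st_H(γ, f)` for `f ∈ C_c^∞(H_v)`, `G`-regular `γ`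
  (§2 + additivity ★ `localStableOrbitalIntegralH_add_of_isLocSmooth`).

All three are pure plumbing over ★ lemmas; no analysis.  Consumed by `Theorems/K2E4SplitTransferGermLift.lean` (the (LIFT_v) payer).

HONEST LABEL: HC_CM is proved only modulo the 7 printed citations (2 remaining named inputs: hLiu418 = stmt-HodgeConjecture-24832, h413 =
stmt-HodgeConjecture-24833) until rung 0 closes; this file is a `--supports stmt-HodgeConjecture-24833` helper and proves no printed analytic statement.

## References
* [Rogawski1990] J. D. Rogawski, *Automorphic Representations of Unitary Groups in Three Variables*, Ann. of Math. Stud. 123 (1990): §4.1 (4.1.1) p. 39; §4.3 (4.3.1)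
  p. 43; §4.9 p. 54; §4.13 Lemma 4.13.1 (a) p. 64; §14.2 p. 232.
* [BernsteinZelevinsky1976] I. N. Bernstein, A. V. Zelevinsky, *Representations of the group GL(n, F) where F is a non-archimedean local field*, Russian Math.
  Surveys 31 (1976), §1.1–§1.2.
-/

set_option autoImplicit false
set_option linter.dupNamespace false

noncomputable section

open MeasureTheory Measure NumberField IsDedekindDomain
open Literature.MeasureTheory.Group
open Literature.NumberTheory.Rogawski1990 Literature.NumberTheory.Automorphic Literature.NumberTheory.GaloisRepresentations
open scoped MatrixGroups

namespace Summit.HodgeConjecture.HodgeConjecture.Cruxes.H413.K2E4SplitTransferGermLiftKit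

variable (L : Type) [Field L] [NumberField L] [IsCMField L] (v : HeightOneSpectrum (𝓞 ↥(maximalRealSubfield L)))
  [∀ a : ((UnitaryGroup.cmDatum L 2 (Matrix.of fun i j : Fin 2 => if i.val + j.val + 1 = 2 then (1 : L) else 0)).Local v × (UnitaryGroup.cmDatum L 1 (Matrix.of fun i j : Fin 1 => if i.val + j.val + 1 = 1 then (1 : L) else 0)).Local v), MeasurableSpace (((UnitaryGroup.cmDatum L 2 (Matrix.of fun i j : Fin 2 => if i.val + j.val + 1 = 2 then (1 : L) else 0)).Local v × (UnitaryGroup.cmDatum L 1 (Matrix.of fun i j : Fin 1 => if i.val + j.val + 1 = 1 then (1 : L) else 0)).Local v) ⧸ Subgroup.centralizer ({a} : Set ((UnitaryGroup.cmDatum L 2 (Matrix.of fun i j : Fin 2 => if i.val + j.val + 1 = 2 then (1 : L) else 0)).Local v × (UnitaryGroup.cmDatum L 1 (Matrix.of fun i j : Fin 1 => if i.val + j.val + 1 = 1 then (1 : L) else 0)).Local v)))]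
  [∀ a : ((UnitaryGroup.cmDatum L 2 (Matrix.of fun i j : Fin 2 => if i.val + j.val + 1 = 2 then (1 : L) else 0)).Local v × (UnitaryGroup.cmDatum L 1 (Matrix.of fun i j : Fin 1 => if i.val + j.val + 1 = 1 then (1 : L) else 0)).Local v), BorelSpace (((UnitaryGroup.cmDatum L 2 (Matrix.of fun i j : Fin 2 => if i.val + j.val + 1 = 2 then (1 : L) else 0)).Local v × (UnitaryGroup.cmDatum L 1 (Matrix.of fun i j : Fin 1 => if i.val + j.val + 1 = 1 then (1 : L) else 0)).Local v) ⧸ Subgroup.centralizer ({a} : Set ((UnitaryGroup.cmDatum L 2 (Matrix.of fun i j : Fin 2 => if i.val + j.val + 1 = 2 then (1 : L) else 0)).Local v × (UnitaryGroup.cmDatum L 1 (Matrix.of fun i j : Fin 1 => if i.val + j.val + 1 = 1 then (1 : L) else 0)).Local v)))]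

/-! ## §1 A conjugation-invariant factor comes out of `Φ^st_H` at a split place -/

omit [∀ a : ((UnitaryGroup.cmDatum L 2 (Matrix.of fun i j : Fin 2 => if i.val + j.val + 1 = 2 then (1 : L) else 0)).Local v × (UnitaryGroup.cmDatum L 1 (Matrix.of fun i j : Fin 1 => if i.val + j.val + 1 = 1 then (1 : L) else 0)).Local v), BorelSpace (((UnitaryGroup.cmDatum L 2 (Matrix.of fun i j : Fin 2 => if i.val + j.val + 1 = 2 then (1 : L) else 0)).Local v × (UnitaryGroup.cmDatum L 1 (Matrix.of fun i j : Fin 1 => if i.val + j.val + 1 = 1 then (1 : L) else 0)).Local v) ⧸ Subgroup.centralizer ({a} : Set ((UnitaryGroup.cmDatum L 2 (Matrix.of fun i j : Fin 2 => if i.val + j.val + 1 = 2 then (1 : L) else 0)).Local v × (UnitaryGroup.cmDatum L 1 (Matrix.of fun i j : Fin 1 => if i.val + j.val + 1 = 1 then (1 : L) else 0)).Local v)))] in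
/-- **`Φ^st_H(γ, g·ψ) = g(γ)·Φ^st_H(γ, ψ)` at a SPLIT place for a conjugation-invariant `g`** (any family, any `γ`): at a split `v` the stable class of `γ` is its
conjugacy class (★ `stableOrbitalIntegralRel_isLocalStablyConjH_eq_of_split`), the class integral is the point integral at the representative `out ⟦γ⟧`, a class
function comes out of an orbital integral (★ `orbitalIntegral_mul_of_forall_conj_eq`), and `g (out ⟦γ⟧) = g γ`.
[cite: Rogawski1990, §4.9 p. 54; §14.2 p. 232; §4.1 (4.1.1) p. 39] -/
theorem stableOrbitalIntegralRel_mul_of_forall_conj_eq_of_split (w : UnitaryGroup.PlacesOver L v) (hw : IsCMField.complexConj L • w.1 ≠ w.1)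
    (mHv : OrbitalMeasureFamily ((UnitaryGroup.cmDatum L 2 (Matrix.of fun i j : Fin 2 => if i.val + j.val + 1 = 2 then (1 : L) else 0)).Local v × (UnitaryGroup.cmDatum L 1 (Matrix.of fun i j : Fin 1 => if i.val + j.val + 1 = 1 then (1 : L) else 0)).Local v)) (g ψ : ((UnitaryGroup.cmDatum L 2 (Matrix.of fun i j : Fin 2 => if i.val + j.val + 1 = 2 then (1 : L) else 0)).Local v × (UnitaryGroup.cmDatum L 1 (Matrix.of fun i j : Fin 1 => if i.val + j.val + 1 = 1 then (1 : L) else 0)).Local v) → ℂ) (hg : ∀ y x, g (y * x * y⁻¹) = g x) (γ : ((UnitaryGroup.cmDatum L 2 (Matrix.of fun i j : Fin 2 => if i.val + j.val + 1 = 2 then (1 : L) else 0)).Local v × (UnitaryGroup.cmDatum L 1 (Matrix.of fun i j : Fin 1 => if i.val + j.val + 1 = 1 then (1 : L) else 0)).Local v)) :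
    stableOrbitalIntegralRel (IsLocalStablyConjH L v) mHv (fun x => g x * ψ x) γ =
      g γ * stableOrbitalIntegralRel (IsLocalStablyConjH L v) mHv ψ γ := by
  rw [stableOrbitalIntegralRel_isLocalStablyConjH_eq_of_split L w hw (UnitaryGroup.antidiagOne_isHermitian L 2)
      (UnitaryGroup.isUnit_antidiagOne_det L 2).ne_zero (UnitaryGroup.antidiagOne_isHermitian L 1) (UnitaryGroup.isUnit_antidiagOne_det L 1).ne_zero mHv _ γ,
    stableOrbitalIntegralRel_isLocalStablyConjH_eq_of_split L w hw (UnitaryGroup.antidiagOne_isHermitian L 2)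
      (UnitaryGroup.isUnit_antidiagOne_det L 2).ne_zero (UnitaryGroup.antidiagOne_isHermitian L 1) (UnitaryGroup.isUnit_antidiagOne_det L 1).ne_zero mHv ψ γ,
    classOrbitalIntegral_eq, classOrbitalIntegral_eq, orbitalIntegral_mul_of_forall_conj_eq _ _ g ψ (fun y => hg y _)]
  have hgo : g (Quotient.out (ConjClasses.mk γ)) = g γ := by
    obtain ⟨c, hc⟩ := isConj_iff.1 (ConjClasses.mk_eq_mk_iff_isConj.1 (Quotient.out_eq (ConjClasses.mk γ)))
    calc g (Quotient.out (ConjClasses.mk γ)) = g (c * Quotient.out (ConjClasses.mk γ) * c⁻¹) := (hg c _).symm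
      _ = g γ := by rw [hc]
  rw [hgo]

/-! ## §2 `Φ^st_H` does not see conjugation of the test function (every finite place) -/

/-- **`Φ^st_H(γ, f ∘ Ad k) = Φ^st_H(γ, f)` at a `G`-regular `γ`** for a family admissible on the `G`-regular classes: every class of the stable class of `γ` is
`G`-regular (★ `isLocalGRegular_of_isLocalStablyConjH`), its member is `H_v`-invariant, and an orbital integral against an invariant measure does not see `Ad k` (★
`orbitalIntegral_conj_eq`). [cite: Rogawski1990, §4.9 p. 54; §4.1 (4.1.1) p. 39] [cite: BernsteinZelevinsky1976, §1.2] -/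
theorem stableOrbitalIntegralRel_comp_conj {mHv : OrbitalMeasureFamily ((UnitaryGroup.cmDatum L 2 (Matrix.of fun i j : Fin 2 => if i.val + j.val + 1 = 2 then (1 : L) else 0)).Local v × (UnitaryGroup.cmDatum L 1 (Matrix.of fun i j : Fin 1 => if i.val + j.val + 1 = 1 then (1 : L) else 0)).Local v)} (hadm : mHv.IsAdmissibleOn (IsLocalGRegular L v))
    (f : ((UnitaryGroup.cmDatum L 2 (Matrix.of fun i j : Fin 2 => if i.val + j.val + 1 = 2 then (1 : L) else 0)).Local v × (UnitaryGroup.cmDatum L 1 (Matrix.of fun i j : Fin 1 => if i.val + j.val + 1 = 1 then (1 : L) else 0)).Local v) → ℂ) (k γ : ((UnitaryGroup.cmDatum L 2 (Matrix.of fun i j : Fin 2 => if i.val + j.val + 1 = 2 then (1 : L) else 0)).Local v × (UnitaryGroup.cmDatum L 1 (Matrix.of fun i j : Fin 1 => if i.val + j.val + 1 = 1 then (1 : L) else 0)).Local v)) (hγ : IsLocalGRegular L v γ) :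
    stableOrbitalIntegralRel (IsLocalStablyConjH L v) mHv (fun x => f (k * x * k⁻¹)) γ =
      stableOrbitalIntegralRel (IsLocalStablyConjH L v) mHv f γ := by
  simp only [stableOrbitalIntegralRel_def]
  refine finsum_mem_congr rfl fun c hc => ?_
  have hreg : IsLocalGRegular L v (Quotient.out c) := isLocalGRegular_of_isLocalStablyConjH L v hc hγ
  haveI := hadm.smulInvariantMeasure hreg
  have hf : (fun x => f (k * x * k⁻¹)) = f ∘ MulAut.conj k := by funext x; rfl
  rw [classOrbitalIntegral_eq, classOrbitalIntegral_eq, hf]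
  exact orbitalIntegral_conj_eq _ _ k f

/-! ## §3 The finite conjugation sum multiplies `Φ^st_H` by the number of terms -/

/-- **`Φ^st_H(γ, x ↦ Σ_{i<n} f(k_i x k_i⁻¹)) = n · Φ^st_H(γ, f)`** for `f ∈ C_c^∞(H_v)` at a `G`-regular `γ`, family admissible on the `G`-regular classes (§2 term by
term + additivity of `Φ^st_H` on `C_c^∞` at `G`-regular points ★ `localStableOrbitalIntegralH_add_of_isLocSmooth`; induction on the index set).
[cite: Rogawski1990, §4.3 (4.3.1) p. 43; §4.9 p. 54] [cite: BernsteinZelevinsky1976, §1.2] -/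
theorem stableOrbitalIntegralRel_sum_conj {mHv : OrbitalMeasureFamily ((UnitaryGroup.cmDatum L 2 (Matrix.of fun i j : Fin 2 => if i.val + j.val + 1 = 2 then (1 : L) else 0)).Local v × (UnitaryGroup.cmDatum L 1 (Matrix.of fun i j : Fin 1 => if i.val + j.val + 1 = 1 then (1 : L) else 0)).Local v)} (hadm : mHv.IsAdmissibleOn (IsLocalGRegular L v))
    {f : ((UnitaryGroup.cmDatum L 2 (Matrix.of fun i j : Fin 2 => if i.val + j.val + 1 = 2 then (1 : L) else 0)).Local v × (UnitaryGroup.cmDatum L 1 (Matrix.of fun i j : Fin 1 => if i.val + j.val + 1 = 1 then (1 : L) else 0)).Local v) → ℂ} (hf : IsLocSmooth f) {n : ℕ} (k : Fin n → ((UnitaryGroup.cmDatum L 2 (Matrix.of fun i j : Fin 2 => if i.val + j.val + 1 = 2 then (1 : L) else 0)).Local v × (UnitaryGroup.cmDatum L 1 (Matrix.of fun i j : Fin 1 => if i.val + j.val + 1 = 1 then (1 : L) else 0)).Local v)) (γ : ((UnitaryGroup.cmDatum L 2 (Matrix.of fun i j : Fin 2 => if i.val + j.val + 1 = 2 then (1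 : L) else 0)).Local v × (UnitaryGroup.cmDatum L 1 (Matrix.of fun i j : Fin 1 => if i.val + j.val + 1 = 1 then (1 : L) else 0)).Local v)) (hγ : IsLocalGRegular L v γ) :
    stableOrbitalIntegralRel (IsLocalStablyConjH L v) mHv (fun x => ∑ i, f (k i * x * (k i)⁻¹)) γ =
      (n : ℂ) * stableOrbitalIntegralRel (IsLocalStablyConjH L v) mHv f γ := by
  classical
  -- the statement for every finset of indices
  suffices h : ∀ s : Finset (Fin n), stableOrbitalIntegralRel (IsLocalStablyConjH L v) mHv (fun x => ∑ i ∈ s, f (k i * x * (k i)⁻¹)) γ =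
      (s.card : ℂ) * stableOrbitalIntegralRel (IsLocalStablyConjH L v) mHv f γ by
    simpa only [Finset.card_univ, Fintype.card_fin] using h Finset.univ
  intro s
  induction s using Finset.induction_on with
  | empty =>
    have h0 : (fun x : ((UnitaryGroup.cmDatum L 2 (Matrix.of fun i j : Fin 2 => if i.val + j.val + 1 = 2 then (1 : L) else 0)).Local v × (UnitaryGroup.cmDatum L 1 (Matrix.of fun i j : Fin 1 => if i.val + j.val + 1 = 1 then (1 : L) else 0)).Local v) => ∑ i ∈ (∅ : Finset (Fin n)), f (k i * x * (k i)⁻¹)) = 0 := by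
      funext x; simp only [Finset.sum_empty, Pi.zero_apply]
    rw [h0, stableOrbitalIntegralRel_zero, Finset.card_empty, Nat.cast_zero, zero_mul]
  | insert a s ha ih =>
    have hsplit : (fun x : ((UnitaryGroup.cmDatum L 2 (Matrix.of fun i j : Fin 2 => if i.val + j.val + 1 = 2 then (1 : L) else 0)).Local v × (UnitaryGroup.cmDatum L 1 (Matrix.of fun i j : Fin 1 => if i.val + j.val + 1 = 1 then (1 : L) else 0)).Local v) => ∑ i ∈ insert a s, f (k i * x * (k i)⁻¹)) =
        (fun x => f (k a * x * (k a)⁻¹)) + fun x => ∑ i ∈ s, f (k i * x * (k i)⁻¹) := by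
      funext x; simp only [Finset.sum_insert ha, Pi.add_apply]
    have hs : IsLocSmooth (fun x : ((UnitaryGroup.cmDatum L 2 (Matrix.of fun i j : Fin 2 => if i.val + j.val + 1 = 2 then (1 : L) else 0)).Local v × (UnitaryGroup.cmDatum L 1 (Matrix.of fun i j : Fin 1 => if i.val + j.val + 1 = 1 then (1 : L) else 0)).Local v) => ∑ i ∈ s, f (k i * x * (k i)⁻¹)) := by
      have hfun : (fun x : ((UnitaryGroup.cmDatum L 2 (Matrix.of fun i j : Fin 2 => if i.val + j.val + 1 = 2 then (1 : L) else 0)).Local v × (UnitaryGroup.cmDatum L 1 (Matrix.of fun i j : Fin 1 => if i.val + j.val + 1 = 1 then (1 : L) else 0)).Local v) => ∑ i ∈ s, f (k i * x * (k i)⁻¹)) = ∑ i ∈ s, fun x => f (k i * x * (k i)⁻¹) := by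
        funext x; simp only [Finset.sum_apply]
      rw [hfun]
      exact IsLocSmooth.finset_sum s fun i _ => isLocSmooth_comp_conj hf (k i)
    rw [hsplit, localStableOrbitalIntegralH_add_of_isLocSmooth L v hadm γ hγ _ _ (isLocSmooth_comp_conj hf (k a)) hs,
      stableOrbitalIntegralRel_comp_conj L v hadm f (k a) γ hγ, ih, Finset.card_insert_of_notMem ha, Nat.cast_succ]
    ring

end Summit.HodgeConjecture.HodgeConjecture.Cruxes.H413.K2E4SplitTransferGermLiftKit

end
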